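import Literature.Computability.Cryptography.CommitmentsSignatures
import Literature.Computability.Cryptography.AffineHashProgram
import Literature.Computability.Cryptography.HybridSampling
import Literature.Computability.Complexity.FoldCatBricks
import HarnessLib

/-!
# A pseudorandom generator from a bit-commitment scheme, I: parameters and the candidate generators (Luby 1996, Thm. 10.3)

Topic `Literature/Computability/Cryptography`. First file of the construction
`BitCommitmentExist → PRGExist` along M. Luby, *Pseudorandomness and Cryptographic Applications* (Princeton UP
1996), Lecture 10, Theorem 10.3 ("If `f` is a false entropy generator then `g` is a pseudorandom generator …
`g(y, y', y'') = ⟨h_{y'}(f'(y)), h'_{y''}(y), y', y''⟩`", with `f'` the `k(n)`-fold direct product of `f`), applied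
to the false-entropy generator `f(b, r) = ⟨commit(1ⁿ, b; r), b⟩` of an efficient, computationally hiding,
statistically binding non-interactive bit-commitment scheme (`CommitmentsSignatures.lean`; Luby, Lecture 13,
p. 137: "the input bit `b` … is statistically committed but still hidden given the output value").

Two parameters of the printed construction are not computable in the tree's model and are therefore
GUESSED, the guesses being the index of a polynomial family of candidate generators (to be combined by
`XorCombiner.lean` after stretching by `PRGStretchIndexed.lean`): the sender's coin count
`ρ(n) = coinLenAt n b ≤ J(n)` (an arbitrary polynomially bounded function, `Randomized.lean`) and the Shannon
entropy `H(C)` of the commitment string, guessed to precision `¼` (Luby's construction uses `ent(f(X))` and the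
degeneracy in the output lengths of the two hash functions). This file fixes, for a `Setup` (the scheme with
two polynomial bounds), the level-`n` parameters — block length `L0 = J + 1` (bit and coins), `t = 4c²(n+1)`
copies (`c = 2L0 + 2`), deviation `Δ = 2·L0·c·(n+1)` of the flattening step, slack `2(n+1)` of the hashing
steps, hash output lengths `m1 n j = (t/4)j + t − Δ − 2(n+1) − 1` (on the `t` committed pairs) and
`m2 n j = tL0 − (t/4)(j+1) − Δ − 2(n+1) − 1` (on the seed blocks), key lengths `K1, K2`, seed length
`a = K1 + K2 + t·L0` — and the candidate generators as plain functions on strings: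

* `cand S n i s` — on seed `s = κ₁ ‖ κ₂ ‖ x` (`|x| = t·L0`, blocks `xℓ = bℓ ‖ rℓ`), with `(ρ̃, j)` decoded from
  `i`: `κ₁ ‖ κ₂ ‖ (h¹_{κ₁}(z) ‖ h²_{κ₂}(x) ‖ 0…)↾(t·L0 + 1)`, where `z` codes the `t` pairs
  `(commit(1ⁿ, bℓ; rℓ↾ρ̃), bℓ)` (each commitment with a unary length header and zero-padded, `2·Qc + 1` bits per
  pair, injectively: `encP_inj`) and `h¹, h²` are the string-keyed affine hash functions (`AffineStr.hashStr`) to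
  `m1 n j`, `m2 n j` bits; `aP`, `mP` are the seed length and the number of candidates as polynomials;
* `candI S ⟨1ⁿ, ⟨1ⁱ, s⟩⟩ = cand S n i s` (the indexed-sampler format of `XorCombiner.lean`);
* the length bookkeeping (`length_cand`: `a n + 1` on `a n`-bit seeds) and **`xLen_lt_m1_add_m2`**: for every
  guess `j ≤ 4·L0` the two hash outputs together exceed `t·L0` bits, so the good candidate stretches by one bit;
* `comB` — the sender's algorithm as a string function `⟨u, ⟨v, r⟩⟩ ↦ commit(1^{|u|}, head v; r)`, in `FP` for an
  efficient scheme (`comB_mem_FP`), and `Setup.exists_wf`: every efficient scheme has a well-formed `Setup`.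

All definitions and lemmas here are elementary; no named facts. The machine (`candI ∈ FP`), the reduction
from hiding and the security proof are the sequels.

## References

* M. Luby, *Pseudorandomness and Cryptographic Applications*, Princeton University Press 1996, Lecture 10,
  Thm. 10.3 (construction and proof), Lecture 8 (Smoothing Entropy Theorem), Lecture 13, p. 137.
* J. Håstad, R. Impagliazzo, L. A. Levin, M. Luby, *A pseudorandom generator from any one-way function*,
  SIAM J. Comput. 28 (1999) 1364–1396, §4 (false entropy, enumeration of the entropy guesses).
* O. Goldreich, *Foundations of Cryptography I*, CUP 2001, Def. 4.4.1 (bit commitment), §2.2.3.2 (padding to fixed lengths).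
-/

namespace Literature.Computability.Cryptography

open _root_.Computability Complexity Complexity.Brick Complexity.Plumb Polynomial Hybrid AffineStr

namespace ComPRG

/-! ### The setup: a scheme with its two polynomial bounds -/

/-- **The sender's algorithm as a string function**: `comB C ⟨u, ⟨v, r⟩⟩ = commit(1^{|u|}, head v; r)`.
[cite: Goldreich2001, Def. 4.4.1 (the commit phase)] -/
def comB (C : BitCommitment) (w : List Bool) : List Bool :=
  C.commit.run ((fstF w).length, (fstF (sndF w)).headD false) (sndF (sndF w))

/-- The normaliser `⟨u, ⟨v, r⟩⟩ ↦ ⟨⟨1^{|u|}, [head v]⟩, r⟩` (the sender's input code `commitCode`). [folklore] -/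
noncomputable def nrmB : List Bool → List Bool :=
  fanoutFn (fanoutFn (onesFn ∘ fstF) (HashBricks.headBitFn ∘ fstF ∘ sndF)) (sndF ∘ sndF)

/-- `nrmB` produces the sender's input code. [folklore] -/
theorem nrmB_apply (w : List Bool) :
    nrmB w = boolPair (commitCode ((fstF w).length, (fstF (sndF w)).headD false)) (sndF (sndF w)) := by
  have hb : ∀ b : Bool, encodeBool b = [b] := fun b => by cases b <;> rfl
  simp [nrmB, commitCode, onesFn, hb]

/-- **`comB C ∈ FP`** for an efficient scheme. [cite: Goldreich2001, Def. 4.4.1 (both parties are PPT)] -/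
theorem comB_mem_FP {C : BitCommitment} (hC : C.IsEfficient) : comB C ∈ FP := by
  have hnrm : nrmB ∈ FP :=
    fanoutFn_mem_FP (fanoutFn_mem_FP (comp_mem_FP onesFn_mem_FP fstF_mem_FP)
      (comp_mem_FP HashBricks.headBitFn_mem_FP (comp_mem_FP fstF_mem_FP sndF_mem_FP))) (comp_mem_FP sndF_mem_FP sndF_mem_FP)
  have hdec : PolyTimeComputable (id : List Bool → List Bool)
      (fun p : (ℕ × Bool) × List Bool => boolPair (commitCode p.1) p.2)
      (fun w => (((fstF w).length, (fstF (sndF w)).headD false), sndF (sndF w))) :=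
    PolyTimeComputable.of_encode_eq (f := nrmB) (id : List Bool → List Bool) (fun _ => rfl)
      (fun w => by rw [nrmB_apply]; rfl) hnrm
  exact PolyTimeComputable.comp_holds hC.1 hdec

/-- An `FP` function has polynomially bounded output length (private copy, not in the import closure).
[Arora–Barak 2009, §1.3] [folklore] -/
private theorem exists_poly_length_le_of_FP {f : List Bool → List Bool} (hf : f ∈ FP) :
    ∃ q : Polynomial ℕ, ∀ x, (f x).length ≤ q.eval x.length := by
  obtain ⟨p, M, hM⟩ := hf
  refine ⟨X + Polynomial.C (TM2Comp.machinePushBound M.tm) * p, fun x => ?_⟩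
  have h := (hM x).length_le
  simpa using h

/-- **The setup**: a bit-commitment scheme with a polynomial `Jp` bounding the sender's coin count
(`coinLen L ≤ Jp(L)`) and a polynomial `Qp` bounding the length of the sender's output as a function of the
length of `⟨1ⁿ, ⟨[b], r⟩⟩`. [cite: Goldreich2001, Def. 4.4.1] -/
structure Setup where
  /-- the scheme [cite: Goldreich2001, Def. 4.4.1] -/
  C : BitCommitment
  /-- coin bound [folklore] -/
  Jp : Polynomial ℕ
  /-- output-length bound [folklore] -/
  Qp : Polynomial ℕ

namespace Setup

variable (S : Setup)

/-- Well-formedness: the two bounds hold and the sender is polynomial-time. [cite: Goldreich2001, Def. 4.4.1] -/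
structure WF : Prop where
  /-- `coinLen L ≤ Jp(L)` [folklore] -/
  hJ : ∀ L, S.C.commit.coinLen L ≤ S.Jp.eval L
  /-- `|comB w| ≤ Qp(|w|)` [folklore] -/
  hQ : ∀ w, (comB S.C w).length ≤ S.Qp.eval w.length
  /-- `comB ∈ FP` [folklore] -/
  hcom : comB S.C ∈ FP

/-- **Every efficient scheme has a well-formed setup.** [cite: Goldreich2001, Def. 4.4.1] -/
theorem exists_wf {C : BitCommitment} (hC : C.IsEfficient) : ∃ S : Setup, S.C = C ∧ S.WF := by
  obtain ⟨Jp, hJ⟩ := hC.2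
  obtain ⟨Qp, hQ⟩ := exists_poly_length_le_of_FP (comB_mem_FP hC)
  exact ⟨⟨C, Jp, Qp⟩, rfl, ⟨hJ, hQ, comB_mem_FP hC⟩⟩

/-! ### Level parameters -/

/-- `J n = Jp(2n + 3)`: a bound on the sender's coin count `ρ(n) = coinLenAt n b` (`|commitCode (n, b)| = 2n + 3`).
[folklore] -/
def J (n : ℕ) : ℕ := S.Jp.eval (2 * n + 3)

/-- `L0 n = J n + 1`: the block length (one committed bit, `J n` coins). [cite: Luby1996, Lecture 10, Theorem 10.3 (the input `x` of `f`)] -/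
def L0 (n : ℕ) : ℕ := S.J n + 1

/-- `Qc n = Qp(2n + 6 + J n)`: a bound on the length of the commitment strings at level `n`. [folklore] -/
def Qc (n : ℕ) : ℕ := S.Qp.eval (2 * n + 6 + S.J n)

/-- `Lz n = 2·Qc n + 1`: the length of one coded pair (unary length header and zero-padded commitment,
`Qc` bits each, then the bit). [folklore] -/
def Lz (n : ℕ) : ℕ := 2 * S.Qc n + 1

/-- `cst n = 2·L0 + 2`. [folklore] -/
def cst (n : ℕ) : ℕ := 2 * S.L0 n + 2

/-- `t4 n = cst²·(n+1)`, a quarter of the number of copies. [folklore] -/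
def t4 (n : ℕ) : ℕ := S.cst n ^ 2 * (n + 1)

/-- `t n = 4·cst²·(n+1)` copies (`k(n)` of the printed construction). [cite: Luby1996, Lecture 10, Theorem 10.3 (`k(n)` copies)] -/
def t (n : ℕ) : ℕ := 4 * S.t4 n

/-- `Δ n = 2·L0·cst·(n+1)`: the entropy deviation allowed in the flattening steps (`tη·log₂|Ω|` with
`tη² = n + 1`, `log₂|Ω| = L0`). [cite: Luby1996, Lecture 10, Theorem 10.3 (proof, the `k(n)^{5/6}` slack)] -/
def Δ (n : ℕ) : ℕ := S.L0 n * (2 * S.cst n * (n + 1))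

/-- `sl n = n + 1`: the slack of each hashing step (distance `½·2^{−sl}`). [folklore] -/
def sl (n : ℕ) : ℕ := n + 1

/-- `xLen n = t·L0`: the length of the block part `x` of the seed (`y ∈ {0,1}^{k(n)×n}`). [cite: Luby1996, Lecture 10, Theorem 10.3] -/
def xLen (n : ℕ) : ℕ := S.t n * S.L0 n

/-- **`m1 n j`**: the output length of the hash of the `t` committed pairs for the entropy guess `j`
(`H(C) ∈ [j/4, (j+1)/4)`): `(t/4)·j + t − Δ − 2·sl − 1` (the printed `(n − d(n) + p(n))k(n) − 2k(n)^{5/6}`).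
[cite: Luby1996, Lecture 10, Theorem 10.3 (the range of `h`)] -/
def m1 (n j : ℕ) : ℕ := S.t4 n * j + S.t n - S.Δ n - 2 * sl n - 1

/-- **`m2 n j`**: the output length of the hash of the seed blocks for the guess `j`:
`t·L0 − ((t/4)(j+1) + Δ + 2·sl + 1)` (the printed `d(n)k(n) − 2k(n)^{5/6}`; truncated at `0`).
[cite: Luby1996, Lecture 10, Theorem 10.3 (the range of `h'`)] -/
def m2 (n j : ℕ) : ℕ := S.xLen n - (S.t4 n * (j + 1) + S.Δ n + 2 * sl n + 1)

/-- `M1 n = t·L0 + t`: a common bound on `m1 n j` for `j ≤ 4·L0`. [folklore] -/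
def M1 (n : ℕ) : ℕ := S.xLen n + S.t n

/-- `K1 n = M1·(t·Lz + 1)`: the key length of the first hash (`{0,1}^{t·Lz} → {0,1}^{≤ M1}`). [cite: Luby1996, Lecture 8 (universal hash functions, key length)] -/
def K1 (n : ℕ) : ℕ := S.M1 n * (S.t n * S.Lz n + 1)

/-- `K2 n = xLen·(xLen + 1)`: the key length of the second hash (`{0,1}^{xLen} → {0,1}^{≤ xLen}`). [cite: Luby1996, Lecture 8 (universal hash functions, key length)] -/
def K2 (n : ℕ) : ℕ := S.xLen n * (S.xLen n + 1)

/-- **`a n = K1 + K2 + xLen`**: the seed length at level `n`. [cite: Luby1996, Lecture 10, Theorem 10.3 (`(y, y', y'')`)] -/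
def a (n : ℕ) : ℕ := S.K1 n + S.K2 n + S.xLen n

/-- `mCnt n = (J + 1)·(4·L0 + 1)`: the number of candidates (coin-count guesses times entropy guesses). [folklore] -/
def mCnt (n : ℕ) : ℕ := (S.J n + 1) * (4 * S.L0 n + 1)

/-- The coin-count guess decoded from the candidate index. [folklore] -/
def rhoOf (n i : ℕ) : ℕ := i % (S.J n + 1)

/-- The entropy guess decoded from the candidate index. [folklore] -/
def jOf (n i : ℕ) : ℕ := i / (S.J n + 1)

/-- The index of the pair of guesses `(ρ̃, j)`. [folklore] -/
def idxOf (n ρ j : ℕ) : ℕ := ρ + (S.J n + 1) * j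

/-- `rhoOf_idxOf`. [folklore] -/
theorem rhoOf_idxOf {n ρ : ℕ} (hρ : ρ ≤ S.J n) (j : ℕ) : S.rhoOf n (S.idxOf n ρ j) = ρ := by
  unfold rhoOf idxOf
  rw [Nat.add_mul_mod_self_left, Nat.mod_eq_of_lt (by omega)]

/-- `jOf_idxOf`. [folklore] -/
theorem jOf_idxOf {n ρ : ℕ} (hρ : ρ ≤ S.J n) (j : ℕ) : S.jOf n (S.idxOf n ρ j) = j := by
  unfold jOf idxOf
  rw [Nat.add_mul_div_left _ _ (by omega), Nat.div_eq_of_lt (by omega), Nat.zero_add]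

/-- `idxOf_lt_mCnt`. [folklore] -/
theorem idxOf_lt_mCnt {n ρ j : ℕ} (hρ : ρ ≤ S.J n) (hj : j ≤ 4 * S.L0 n) : S.idxOf n ρ j < S.mCnt n := by
  unfold idxOf mCnt
  have h1 : (S.J n + 1) * j ≤ (S.J n + 1) * (4 * S.L0 n) := Nat.mul_le_mul_left _ hj
  have h2 : (S.J n + 1) * (4 * S.L0 n + 1) = (S.J n + 1) * (4 * S.L0 n) + (S.J n + 1) := by ring
  omega

/-- `t = 4·t4`. [folklore] -/
theorem t_eq (n : ℕ) : S.t n = 4 * S.t4 n := rfl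

/-- **The seed length as a polynomial** (for the ensemble bookkeeping of `XorCombiner.lean`). [folklore] -/
noncomputable def aP : Polynomial ℕ :=
  let JP : Polynomial ℕ := S.Jp.comp (2 * X + 3)
  let L0P : Polynomial ℕ := JP + 1
  let tP : Polynomial ℕ := 4 * ((2 * L0P + 2) ^ 2 * (X + 1))
  let xP : Polynomial ℕ := tP * L0P
  let LzP : Polynomial ℕ := 2 * S.Qp.comp (2 * X + 6 + JP) + 1
  (xP + tP) * (tP * LzP + 1) + xP * (xP + 1) + xP

/-- `aP(n) = a n`. [folklore] -/
theorem aP_eval (n : ℕ) : S.aP.eval n = S.a n := by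
  simp only [aP, eval_add, eval_mul, eval_pow, eval_comp, eval_ofNat, eval_X, eval_one, a, K1, K2, M1, xLen, t, t4, cst,
    Lz, Qc, L0, J]

/-- **The number of candidates as a polynomial.** [folklore] -/
noncomputable def mP : Polynomial ℕ := (S.Jp.comp (2 * X + 3) + 1) * (4 * (S.Jp.comp (2 * X + 3) + 1) + 1)

/-- `mP(n) = mCnt n`. [folklore] -/
theorem mP_eval (n : ℕ) : S.mP.eval n = S.mCnt n := by
  simp only [mP, eval_add, eval_mul, eval_comp, eval_ofNat, eval_X, eval_one, mCnt, L0, J]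

/-- The sender's coin count is within the bound: `coinLenAt n b ≤ J n` (`|commitCode (n, b)| = 2n + 3`). [folklore] -/
theorem coinLenAt_le_J (hS : S.WF) (n : ℕ) (b : Bool) : S.C.coinLenAt n b ≤ S.J n := by
  have hb : ∀ b : Bool, (encodeBool b).length = 1 := fun b => by cases b <;> rfl
  have hlen : (commitCode (n, b)).length = 2 * n + 3 := by
    rw [commitCode, length_boolPair, hb]
    simp
  unfold BitCommitment.coinLenAt J
  rw [hlen]
  exact hS.hJ _

/-- The coin count does not depend on the bit. [folklore] -/
theorem coinLenAt_eq (n : ℕ) (b b' : Bool) : S.C.coinLenAt n b = S.C.coinLenAt n b' := by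
  have hb : ∀ b : Bool, (encodeBool b).length = 1 := fun b => by cases b <;> rfl
  unfold BitCommitment.coinLenAt commitCode
  rw [length_boolPair, length_boolPair, hb, hb]

/-- `1 ≤ L0`. [folklore] -/
theorem one_le_L0 (n : ℕ) : 1 ≤ S.L0 n := by unfold L0; omega

/-- `0 < t`. [folklore] -/
theorem t_pos (n : ℕ) : 0 < S.t n := by
  unfold t t4 cst
  have : 1 ≤ (2 * S.L0 n + 2) ^ 2 := Nat.one_le_pow _ _ (by omega)
  positivity

/-- The arithmetic behind the stretch: `3·t4 ≥ 2Δ + 4·sl + 3` and `t ≥ Δ + 2·sl + 1 + t4`. [folklore] -/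
theorem three_t4_ge (n : ℕ) : 2 * S.Δ n + 4 * sl n + 3 ≤ 3 * S.t4 n := by
  unfold Δ sl t4 cst
  set L := S.L0 n with hL
  have hL1 : 1 ≤ L := S.one_le_L0 n
  have hsq : (2 * L + 2) ^ 2 = (2 * L + 2) * (2 * L + 2) := sq _
  rw [hsq]
  nlinarith [hL1]

/-- **The good candidate stretches by one bit**: `xLen n < m1 n j + m2 n j` for every guess `j ≤ 4·L0 n`.
[cite: Luby1996, Lecture 10, Theorem 10.3 ("g stretches the input by `p(n)k(n) − 4k(n)^{5/6}`, and this is at least 1")] -/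
theorem xLen_lt_m1_add_m2 {n j : ℕ} (hj : j ≤ 4 * S.L0 n) : S.xLen n + 1 ≤ S.m1 n j + S.m2 n j := by
  have h3 := S.three_t4_ge n
  unfold m1 m2 xLen t
  set A := S.t4 n with hA
  set D := S.Δ n with hD
  set s := sl n with hs
  set L := S.L0 n with hL
  have hX : A * j ≤ A * (4 * L) := Nat.mul_le_mul_left _ hj
  have hB : 4 * A * L = A * (4 * L) := by ring
  have hAj : A * (j + 1) = A * j + A := by ring
  rw [hB, hAj]
  omega

/-- `m1 n j ≤ M1 n` for `j ≤ 4·L0 n`. [folklore] -/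
theorem m1_le_M1 {n j : ℕ} (hj : j ≤ 4 * S.L0 n) : S.m1 n j ≤ S.M1 n := by
  unfold m1 M1 xLen t
  have hX : S.t4 n * j ≤ S.t4 n * (4 * S.L0 n) := Nat.mul_le_mul_left _ hj
  have hB : 4 * S.t4 n * S.L0 n = S.t4 n * (4 * S.L0 n) := by ring
  omega

/-- `m2 n j ≤ xLen n`. [folklore] -/
theorem m2_le_xLen (n j : ℕ) : S.m2 n j ≤ S.xLen n := Nat.sub_le _ _

/-! ### The candidate generators as functions on strings -/

/-- `comRun n b r = commit(1ⁿ, b; r)`. [cite: Goldreich2001, Def. 4.4.1] -/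
def comRun (n : ℕ) (b : Bool) (r : List Bool) : List Bool := S.C.commit.run (n, b) r

/-- **The coded pair** `encP n c b = (1^{|c|} 0^{Qc}) ↾ Qc · (c 0^{Qc}) ↾ Qc · b`: a unary length header and the
zero-padded commitment string, `Qc n` bits each, then the bit — `Lz n` bits on EVERY `c`, and injective in
`(c, b)` on the strings with `|c| ≤ Qc n`. [cite: Goldreich2001, §2.2.3.2 (padding to a fixed length)] -/
def encP (n : ℕ) (c : List Bool) (b : Bool) : List Bool :=
  (List.replicate c.length true ++ List.replicate (S.Qc n) false).take (S.Qc n) ++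
    ((c ++ List.replicate (S.Qc n) false).take (S.Qc n) ++ [b])

/-- **The coded pair of a block** `x = b ‖ r`: `encP (commit(1ⁿ, b; r ↾ ρ̃)) b`. [cite: Luby1996, Lecture 10, Theorem 10.3 (`f(y_i)`)] -/
def blockZ (n ρ : ℕ) (x : List Bool) : List Bool :=
  S.encP n (S.comRun n (x.headD false) ((x.drop 1).take ρ)) (x.headD false)

/-- **The coded tuple** `z = blockZ(x₀) ‖ ⋯ ‖ blockZ(x_{t−1})` of the `t` blocks of `x`
(`f'(y) = ⟨f(y₁), …, f(y_{k(n)})⟩`). [cite: Luby1996, Lecture 10, Theorem 10.3 (`f'`)] -/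
def zStr (n ρ : ℕ) (xs : List Bool) : List Bool :=
  ccat (fun ℓ => S.blockZ n ρ (blk (S.L0 n) ℓ xs)) (S.t n)

/-- **The candidate generator** for level `n` and index `i` on the seed `s = κ₁ ‖ κ₂ ‖ x`:
`κ₁ ‖ κ₂ ‖ (h¹_{κ₁}(z) ‖ h²_{κ₂}(x) ‖ 0^{xLen+1}) ↾ (xLen + 1)`.
[cite: Luby1996, Lecture 10, Theorem 10.3 (`g(y, y', y'') = ⟨h_{y'}(f'(y)), h'_{y''}(y), y', y''⟩`)] -/
def cand (n i : ℕ) (s : List Bool) : List Bool :=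
  s.take (S.K1 n) ++ (s.drop (S.K1 n)).take (S.K2 n) ++
    (hashStr (S.t n * S.Lz n) (S.m1 n (S.jOf n i)) (s.take (S.K1 n)) (S.zStr n (S.rhoOf n i) (s.drop (S.K1 n + S.K2 n))) ++
      hashStr (S.xLen n) (S.m2 n (S.jOf n i)) ((s.drop (S.K1 n)).take (S.K2 n)) (s.drop (S.K1 n + S.K2 n)) ++
        List.replicate (S.xLen n + 1) false).take (S.xLen n + 1)

/-- **The indexed sampler** `candI ⟨1ⁿ, ⟨1ⁱ, s⟩⟩ = cand n i s` (read through `boolUnpair`, total).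
[cite: Luby1996, Lecture 10, Theorem 10.3] -/
def candI (w : List Bool) : List Bool :=
  S.cand (fstF w).length (fstF (sndF w)).length (sndF (sndF w))

/-- `candI` read at level `n`, index `i`. [folklore] -/
theorem candI_boolPair (n i : ℕ) (s : List Bool) :
    S.candI (boolPair (unaryEncodeNat n) (boolPair (ones i) s)) = S.cand n i s := by
  have h1 : (unaryEncodeNat n).length = n := unary_decode_encode_nat n
  simp only [candI, fstF_boolPair, sndF_boolPair, h1, ones, List.length_replicate]

/-- **Output length `a n + 1` on `a n`-bit seeds** (for every index). [cite: Luby1996, Lecture 10, Theorem 10.3 ("stretches the input by … at least 1")] -/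
theorem length_cand (n i : ℕ) {s : List Bool} (hs : s.length = S.a n) : (S.cand n i s).length = S.a n + 1 := by
  unfold cand
  simp only [List.length_append, List.length_take, List.length_drop, List.length_replicate, hs]
  unfold a
  omega

/-- **The length of a coded pair is `Lz n`, always.** [folklore] -/
theorem length_encP (n : ℕ) (c : List Bool) (b : Bool) : (S.encP n c b).length = S.Lz n := by
  simp only [encP, List.length_append, List.length_take, List.length_replicate, List.length_cons, List.length_nil]
  unfold Lz
  omega

/-- The header of a coded pair within the bound: `1^{|c|} 0^{Qc − |c|}`. [folklore] -/
theorem encP_header {n : ℕ} {c : List Bool} (hc : c.length ≤ S.Qc n) :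
    (List.replicate c.length true ++ List.replicate (S.Qc n) false).take (S.Qc n) =
      List.replicate c.length true ++ List.replicate (S.Qc n - c.length) false := by
  rw [List.take_append, List.take_of_length_le (by rw [List.length_replicate]; exact hc),
    List.length_replicate, List.take_replicate, min_eq_left (Nat.sub_le _ _)]

/-- The body of a coded pair within the bound: `c 0^{Qc − |c|}`. [folklore] -/
theorem encP_body {n : ℕ} {c : List Bool} (hc : c.length ≤ S.Qc n) :
    (c ++ List.replicate (S.Qc n) false).take (S.Qc n) = c ++ List.replicate (S.Qc n - c.length) false := by
  rw [List.take_append, List.take_of_length_le hc, List.take_replicate, min_eq_left (Nat.sub_le _ _)]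

/-- **Coded pairs are injective** (on commitment strings within the bound). [cite: Goldreich2001, §2.2.3.2] -/
theorem encP_inj {n : ℕ} {c c' : List Bool} (hc : c.length ≤ S.Qc n) (hc' : c'.length ≤ S.Qc n) {b b' : Bool}
    (h : S.encP n c b = S.encP n c' b') : c = c' ∧ b = b' := by
  unfold encP at h
  have hl : ((List.replicate c.length true ++ List.replicate (S.Qc n) false).take (S.Qc n)).length =
      ((List.replicate c'.length true ++ List.replicate (S.Qc n) false).take (S.Qc n)).length := by
    simp only [List.length_take, List.length_append, List.length_replicate]; omega
  obtain ⟨h1, h2⟩ := List.append_inj h hl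
  -- the header determines `|c|`
  have hlen : c.length = c'.length := by
    have hcount := congrArg (List.count true) h1
    rw [S.encP_header hc, S.encP_header hc'] at hcount
    simpa [List.count_append, List.count_replicate] using hcount
  have hl2 : ((c ++ List.replicate (S.Qc n) false).take (S.Qc n)).length =
      ((c' ++ List.replicate (S.Qc n) false).take (S.Qc n)).length := by
    simp only [List.length_take, List.length_append, List.length_replicate]; omega
  obtain ⟨h3, h4⟩ := List.append_inj h2 hl2
  rw [S.encP_body hc, S.encP_body hc', hlen] at h3
  exact ⟨List.append_cancel_right h3, by simpa using h4⟩

end Setup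


end ComPRG

end Literature.Computability.Cryptography
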